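import Summits.MatrixMultiplication.OmegaCensus.SmallFormats.MatMul22nRankGF7Slack5Search
import HarnessLib

/-!
# ω-census family (a): replay of the slack-5 search certificate, CHECK B part 5 of 8 (classes `327 ≤ c < 354`)

Cell `pub-omega` (unit `pub-omega-tensor-g16`), topic `Summits/MatrixMultiplication/OmegaCensus` (sub-folder `SmallFormats`).
Framing (verbatim): lottery ticket; floor = certified bounds/negative ranges. HONEST FRAMING: machine-generated kernel replay
(`pub-omega-tensor-g16/code/gen5_runs.py`): `search5 c = true` for the classes `327 ≤ c < 354` (3248 search nodes in 3 `decide`s).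
Meaning (`search5_sound`, `MatMul22nRankGF7Slack5SearchSound`): no LP-tight point of slack 5 has one of these representatives as torus-0 column.
Nothing here is progress on `ω`.
-/

namespace Summit.MatrixMultiplication.OmegaCensus.SmallFormats

set_option Elab.async false

set_option maxRecDepth 100000 in
set_option maxHeartbeats 400000000 in
/-- Classes `327 ≤ c < 344` (1486 nodes). -/
theorem search5_ok_327_344 : ∀ c : Fin 656, 327 ≤ c.val → c.val < 344 → search5 c.val = true := by decide +kernel

set_option maxRecDepth 100000 in
set_option maxHeartbeats 400000000 in
/-- Classes `344 ≤ c < 349` (416 nodes). -/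
theorem search5_ok_344_349 : ∀ c : Fin 656, 344 ≤ c.val → c.val < 349 → search5 c.val = true := by decide +kernel

set_option maxRecDepth 100000 in
set_option maxHeartbeats 400000000 in
/-- Classes `349 ≤ c < 354` (1346 nodes). -/
theorem search5_ok_349_354 : ∀ c : Fin 656, 349 ≤ c.val → c.val < 354 → search5 c.val = true := by decide +kernel

/-- CHECK B for the classes `327 ≤ c < 354`. -/
theorem search5_run_5 : ∀ c : Fin 656, 327 ≤ c.val → c.val < 354 → search5 c.val = true := by
  intro c hlo hhi
  by_cases h344 : c.val < 344
  · exact search5_ok_327_344 c (by omega) h344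
  by_cases h349 : c.val < 349
  · exact search5_ok_344_349 c (by omega) h349
  exact search5_ok_349_354 c (by omega) hhi

end Summit.MatrixMultiplication.OmegaCensus.SmallFormats
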